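import Literature.NumberTheory.Automorphic.JacquetLanglandsSurjectiveOfIntertwiner
import Literature.NumberTheory.Automorphic.StrongMultiplicityOneLevel
import Literature.NumberTheory.Automorphic.LocalComponentGeneric
import HarnessLib

/-!
# Jacquet–Langlands, "onto" half: an intertwiner from a cuspidal `π` never lands on a character

Topic `NumberTheory/Automorphic`; proof-only file (no definition, no named fact), continuing
`JacquetLanglandsSurjectiveOfIntertwiner`. There the named fact
`jacquetLanglands_transfer_surjective` (Gelbart (1975), Thm. 10.5 (ii) "onto"; Jacquet–Langlands,
LNM 114, Thm. 16.1) was reduced (`jacquetLanglands_transfer_surjective_of_intertwiner`, Gelbart's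
claim of p. 152) to the existence, for every cuspidal `π` of `GL₂(𝔸_K)`, of a non-zero bounded
`GL₂(K_v)`-intertwiner (`v ∉ Ram_f(D)`) `T : π → L²(D_𝔸ˣ ⧸ ℝ_{>0} Dˣ)` **whose range is orthogonal to
the one-dimensional constituents** `g ↦ χ(nrd g)`. This file PROVES that the orthogonality clause
is automatic, and removes it:

* `finrank_ne_one_of_intertwiner`: if `π ≤ L²_cusp(GL₂(K) ℝ_{>0} \ GL₂(𝔸_K))` is cuspidal,
  `T : π → L²(D_𝔸ˣ ⧸ ℝ_{>0} Dˣ)` is bounded and `GL₂(K_v)`-equivariant at one finite place `v`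
  (through any `e : D_vˣ ≃* GL₂(K_v)`), and `W ≤ L²(D_𝔸ˣ ⧸ ℝ_{>0} Dˣ)` is a closed invariant subspace
  with `proj_W ∘ T ≠ 0`, then `dim W ≠ 1`. For if `dim W = 1`, the adjoint of `proj_W ∘ T` produces
  a non-zero vector `u ∈ π` on which `GL₂(K_v)` acts through scalars
  (`exists_common_eigenvector_of_intertwiner_finrank_eq_one`); commutators then fix `u`
  (`apply_commutator_eq_self_of_common_eigenvector`), every upper unipotent `(1 t; 0 1)` of
  `GL₂(K_v)` is a commutator (`eq_commutator_of_mem_upperUnitriangular_two`: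
  `u = [diag(2,1), u]`), the stabiliser of `u` is normal, so all of `π` is fixed by
  `ι_v(U₂(K_v))` (`CuspidalAutomorphicRepGL.forall_apply_ofLocal_eq_of_normal`), and the
  irreducible admissible local component of `π` at `v` (`exists_hasLocalComponentAt_holds`) is
  trivial on `U₂(K_v)`, hence not generic (`not_isGeneric_of_upperUnitriangular_le_ker`) —
  contradicting the genericity of the local components of cusp forms on `GL₂`
  (`Shalika1974_isGeneric_of_hasLocalComponentAt_two`, PROVED in the tree: Jacquet–Langlands
  (1970), §9–§11; Cogdell (2004), §1.2). This is Gelbart's remark (p. 151) that "for the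
  remaining places it can be shown that `π'_v` is infinite dimensional", on the `GL₂` side.
* `jacquetLanglands_transfer_surjective_of_intertwiner'`: **`jacquetLanglands_transfer_surjective`
  follows from the existence, for every cuspidal `π` (square-integrable at `Ram_f(D)`, `D` division
  and unramified at infinity), of a non-zero bounded linear `T : π → L²(D_𝔸ˣ ⧸ ℝ_{>0} Dˣ)`
  intertwining `GL₂(K_v)` for every finite `v ∉ Ram_f(D)`** (through fixed splittings `θ₀_v`) —
  the "onto" half of Gelbart's claim "Theorem 10.5 follows from `τ ≅ τ'`" (p. 152) with no side
  condition. (`Ram_f(D)` is finite, `ramifiedPlaces_finite_holds`, and `K` has infinitely many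
  places, `infinite_heightOneSpectrum`, so there is a place at which to run the previous item.)
* `exists_intertwiner_of_subspaceIntertwiner`: an intertwiner given only on a closed subspace
  `M ≤ π` invariant under the `GL₂(K_v)`, `v ∉ Ram_f(D)` — such as Gelbart's `M ∩ π`, on which
  `τ ≅ τ'` lives — extends by zero (`T ∘ proj_M`) to an intertwiner on `π`, the projection being
  equivariant by unitarity; so `hT` may be fed directly from an equivalence `τ ≅ τ'`.

## References

* S. Gelbart, *Automorphic forms on adele groups*, Ann. of Math. Studies 83 (1975), Thm. 10.5 and
  its proof, pp. 148–156 (claim p. 152; p. 151) [Gelbart1975].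
* H. Jacquet, R. P. Langlands, *Automorphic forms on GL(2)*, LNM 114 (1970), §9–§11, Thm. 16.1
  [JacquetLanglands1970].
* J. W. Cogdell, *Analytic theory of L-functions for GL_n*, in *An introduction to the Langlands
  program* (2004), §1.2 [CogdellAnalyticTheory2004].
* D. Bump, *Automorphic forms and representations* (1997), proof of Thm. 3.6.1 [Bump1997].
-/

noncomputable section

open scoped TensorProduct MatrixGroups NNReal InnerProductSpace
open NumberField IsDedekindDomain MeasureTheory TopologicalSpace
open Literature.NumberTheory.Automorphic

universe u

namespace Literature.NumberTheory.Automorphic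

/-! ### Common eigenvectors: commutators act trivially -/

section Eigen

variable {Γ V : Type*} [Group Γ] [AddCommGroup V] [Module ℂ V]

/-- If a vector `u` is a common eigenvector of a group `Γ` acting linearly (`ρ g u = c_g • u` for
all `g`), then every commutator `g h g⁻¹ h⁻¹` fixes `u` (the eigencharacter `g ↦ c_g` is
multiplicative with values in the commutative group `ℂˣ`). [folklore] -/
theorem apply_commutator_eq_self_of_common_eigenvector (ρ : Representation ℂ Γ V) (u : V)
    (hev : ∀ g : Γ, ∃ c : ℂ, ρ g u = c • u) (g h : Γ) :
    ρ (g * h * g⁻¹ * h⁻¹) u = u := by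
  obtain ⟨c₁, hc₁⟩ := hev g
  obtain ⟨c₂, hc₂⟩ := hev h
  obtain ⟨c₃, hc₃⟩ := hev g⁻¹
  obtain ⟨c₄, hc₄⟩ := hev h⁻¹
  have hg : c₃ • c₁ • u = u := by
    have : ρ (g * g⁻¹) u = u := by rw [mul_inv_cancel, map_one, Module.End.one_apply]
    rwa [map_mul, Module.End.mul_apply, hc₃, map_smul, hc₁] at this
  have hh : c₄ • c₂ • u = u := by
    have : ρ (h * h⁻¹) u = u := by rw [mul_inv_cancel, map_one, Module.End.one_apply]
    rwa [map_mul, Module.End.mul_apply, hc₄, map_smul, hc₂] at this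
  have e1 : ρ (g * h * g⁻¹ * h⁻¹) u = c₄ • c₃ • c₂ • c₁ • u := by
    rw [map_mul, map_mul, map_mul, Module.End.mul_apply, Module.End.mul_apply,
      Module.End.mul_apply, hc₄, map_smul, map_smul, map_smul, hc₃, map_smul, map_smul, hc₂,
      map_smul, hc₁]
  rw [e1, smul_comm c₃ c₂, hg, hh]

end Eigen

/-! ### One-dimensional targets: the adjoint produces a common eigenvector -/

section Adjoint

variable {L : Type*} [Group L]
  {H : Type*} [NormedAddCommGroup H] [InnerProductSpace ℂ H] [CompleteSpace H]
  {E : Type*} [NormedAddCommGroup E] [InnerProductSpace ℂ E] [CompleteSpace E]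

omit [CompleteSpace E] in
/-- On a one-dimensional space every linear operator is a scalar: `A w = c • w`. [folklore] -/
theorem exists_apply_eq_smul_of_finrank_eq_one (hE : Module.finrank ℂ E = 1) (A : E →ₗ[ℂ] E)
    (w : E) : ∃ c : ℂ, A w = c • w := by
  by_cases hw : w = 0
  · exact ⟨0, by rw [hw, map_zero, smul_zero]⟩
  · obtain ⟨c, hc⟩ := (finrank_eq_one_iff_of_nonzero' w hw).1 hE (A w)
    exact ⟨c, hc.symm⟩

/-- **A non-zero intertwiner into a one-dimensional unitary representation yields a common
eigenvector.** Let `σ`, `τ` be unitary representations of `L` on Hilbert spaces `H`, `E` with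
`dim E = 1`, and `S : H → E` a non-zero bounded linear map with `S ∘ σ(l) = τ(l) ∘ S`. Then the
adjoint `S†` intertwines the other way (`σ(l) ∘ S† = S† ∘ τ(l)`, as `σ(l)† = σ(l⁻¹)`,
`τ(l)† = τ(l⁻¹)`), so `u = S† w ≠ 0` satisfies `σ(l) u = S† (τ(l) w) = c_l • u`: a non-zero vector
of `H` on which `L` acts through scalars (Riesz representation; Folland (1995), §3.1). [folklore] -/
theorem exists_common_eigenvector_of_intertwiner_finrank_eq_one
    (σ : ContRepresentation ℂ L H) (hσ : σ.IsUnitary) (τ : ContRepresentation ℂ L E)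
    (hτ : τ.IsUnitary) (hE : Module.finrank ℂ E = 1) (S : H →L[ℂ] E) (hS0 : S ≠ 0)
    (hS : ∀ (l : L) (x : H), S (σ l x) = τ l (S x)) :
    ∃ u : H, u ≠ 0 ∧ ∀ l : L, ∃ c : ℂ, σ l u = c • u := by
  have hadj0 : ContinuousLinearMap.adjoint S ≠ 0 := fun h =>
    hS0 ((LinearIsometryEquiv.map_eq_zero_iff ContinuousLinearMap.adjoint).1 h)
  obtain ⟨w, hw⟩ : ∃ w : E, ContinuousLinearMap.adjoint S w ≠ 0 := by
    by_contra h
    push Not at h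
    exact hadj0 (ContinuousLinearMap.ext h)
  refine ⟨ContinuousLinearMap.adjoint S w, hw, fun l => ?_⟩
  obtain ⟨c, hc⟩ :=
    exists_apply_eq_smul_of_finrank_eq_one hE ((τ l : E →L[ℂ] E) : E →ₗ[ℂ] E) w
  rw [ContinuousLinearMap.coe_coe] at hc
  have hcomm : S ∘L σ l⁻¹ = τ l⁻¹ ∘L S := ContinuousLinearMap.ext fun x => hS l⁻¹ x
  have hadj := congrArg ContinuousLinearMap.adjoint hcomm
  rw [ContinuousLinearMap.adjoint_comp, ContinuousLinearMap.adjoint_comp, hσ.adjoint_apply,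
    hτ.adjoint_apply, inv_inv] at hadj
  refine ⟨c, ?_⟩
  have h2 := congrArg (fun A : E →L[ℂ] H => A w) hadj
  simp only [ContinuousLinearMap.comp_apply] at h2
  rw [h2, hc, map_smul]

end Adjoint

/-! ### Upper unipotents of `GL₂` over a field of characteristic zero are commutators -/

section Unipotent

variable {F : Type*} [Field F] [CharZero F]

/-- In `GL₂(F)`, `char F = 0`, every upper unipotent `u = n(t) = (1 t; 0 1)` is the commutator
`d u d⁻¹ u⁻¹` with `d = diag(2, 1)`: `d n(t) d⁻¹ = n(2t) = n(t) n(t)`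
(`diagGL2_mul_unipotentGL2_mul_inv`, `unipotentGL2_add` of `WhittakerBesselGL2`). [folklore] -/
theorem eq_commutator_of_mem_upperUnitriangular_two (u : ↥(upperUnitriangular (Fin 2) F)) :
    ∃ d : GL (Fin 2) F, (u : GL (Fin 2) F) = d * u * d⁻¹ * (u : GL (Fin 2) F)⁻¹ := by
  set t : F := ((u : GL (Fin 2) F) : Matrix (Fin 2) (Fin 2) F) 0 1 with ht
  have hu : unipotentGL2 t = u := unipotentGL2_entry u
  refine ⟨diagGL2 (Units.mk0 (2 : F) two_ne_zero) 1, ?_⟩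
  rw [← hu, diagGL2_mul_unipotentGL2_mul_inv, Units.val_mk0, two_mul, unipotentGL2_add,
    Subgroup.coe_mul, mul_inv_cancel_right]

end Unipotent

/-! ### A cuspidal `π` does not map onto a character -/

section NotCharacter

variable {K : Type} [Field K] [NumberField K] {D : Type u} [Ring D] [Algebra K D]
  [Module.Finite K D]
  {μ_D : Measure (AdelicGroupData.units K D).automorphicQuotient}
  [(AdelicGroupData.units K D).IsAutomorphicMeasure μ_D]
  {μ : Measure (AdelicGroupData.gl 2 K).automorphicQuotient}
  [(AdelicGroupData.gl 2 K).IsAutomorphicMeasure μ] {v : HeightOneSpectrum (𝓞 K)}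

/-- **An intertwiner from a cuspidal `π` of `GL₂(𝔸_K)` never sees a one-dimensional constituent of
`L²(D_𝔸ˣ ⧸ ℝ_{>0} Dˣ)`.** Let `π ≤ L²_cusp(GL₂(K) ℝ_{>0} \ GL₂(𝔸_K))` be cuspidal, `v` a finite place,
`e : D_vˣ ≃* GL₂(K_v)`, `T : π → L²(D_𝔸ˣ ⧸ ℝ_{>0} Dˣ)` bounded and `GL₂(K_v)`-equivariant (through
`GLn.ofLocal` and `Quat.ofLocal ∘ e⁻¹`), and `W ≤ L²(D_𝔸ˣ ⧸ ℝ_{>0} Dˣ)` closed invariant with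
`proj_W ∘ T ≠ 0`. Then `dim W ≠ 1`. Otherwise `proj_W ∘ T : π → W` is a non-zero intertwiner onto a
one-dimensional unitary representation of `GL₂(K_v)`, whose adjoint yields `0 ≠ u ∈ π` on which
`GL₂(K_v)` acts through scalars (`exists_common_eigenvector_of_intertwiner_finrank_eq_one`); the
stabiliser `N` of `u` is then a normal subgroup containing all commutators
(`apply_commutator_eq_self_of_common_eigenvector`), in particular the upper unipotents
(`eq_commutator_of_mem_upperUnitriangular_two`), so `ι_v(U₂(K_v))` fixes all of `π`
(`CuspidalAutomorphicRepGL.forall_apply_ofLocal_eq_of_normal`) and the irreducible admissible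
local component of `π` at `v` (`exists_hasLocalComponentAt_holds`, embedded injectively by
`injective_of_isIrreducible_of_intertwines`) is trivial on `U₂(K_v)`, hence not generic
(`not_isGeneric_of_upperUnitriangular_le_ker`, `exists_whittakerCharFun_ne_one`) — contradicting
`Shalika1974_isGeneric_of_hasLocalComponentAt_two` (local components of cusp forms on `GL₂` are
generic: Jacquet–Langlands (1970), §9–§11; Cogdell (2004), §1.2). Gelbart (1975), p. 151: "for the
remaining places it can be shown that `π'_v` is infinite dimensional".
[cite: Gelbart1975, Thm. 10.5 (proof, p. 151)] [cite: CogdellAnalyticTheory2004, §1.2] -/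
theorem finrank_ne_one_of_intertwiner (P : CuspidalAutomorphicRepGL 2 K μ)
    (e : completionUnits D v ≃* GL (Fin 2) (v.adicCompletion K))
    (T : P.1.toSubmodule →L[ℂ] (AdelicGroupData.units K D).L2 μ_D)
    (hT : ∀ (g : GL (Fin 2) (v.adicCompletion K)) (x : P.1.toSubmodule),
      T (P.1.toContRep (GLn.ofLocal 2 K v g) x) =
        (AdelicGroupData.units K D).rightRegular μ_D (Quat.ofLocal K D v (e.symm g)) (T x))
    (W : ContRepresentation.ClosedSubrep ((AdelicGroupData.units K D).rightRegular μ_D))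
    (hW : ∃ x : P.1.toSubmodule, W.toSubmodule.orthogonalProjectionOnto (T x) ≠ 0) :
    Module.finrank ℂ W.toSubmodule ≠ 1 := by
  intro h1
  haveI : CharZero (v.adicCompletion K) :=
    charZero_of_injective_algebraMap (algebraMap K (v.adicCompletion K)).injective
  have hUG : ((AdelicGroupData.gl 2 K).rightRegular μ).IsUnitary :=
    (AdelicGroupData.gl 2 K).isUnitary_rightRegular μ
  have hUD : ((AdelicGroupData.units K D).rightRegular μ_D).IsUnitary :=
    (AdelicGroupData.units K D).isUnitary_rightRegular μ_D
  -- the two unitary representations of `GL₂(K_v)` and the intertwiner `proj_W ∘ T`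
  let ι : GL (Fin 2) (v.adicCompletion K) →* (AdelicGroupData.gl 2 K).Adelic := GLn.ofLocal 2 K v
  let ι₂ : GL (Fin 2) (v.adicCompletion K) →* (AdelicGroupData.units K D).Adelic :=
    (Quat.ofLocal K D v).comp e.symm.toMonoidHom
  let σ : ContRepresentation ℂ (GL (Fin 2) (v.adicCompletion K)) P.1.toSubmodule :=
    P.1.toContRep.restrict ι
  let τ : ContRepresentation ℂ (GL (Fin 2) (v.adicCompletion K)) W.toSubmodule :=
    W.toContRep.restrict ι₂
  have hσ : σ.IsUnitary := fun l => ClosedSubrep.isUnitary_toContRep hUG P.1 (ι l)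
  have hτ : τ.IsUnitary := fun l => ClosedSubrep.isUnitary_toContRep hUD W (ι₂ l)
  set S : P.1.toSubmodule →L[ℂ] W.toSubmodule := W.toSubmodule.orthogonalProjectionOnto.comp T
    with hS
  have hS0 : S ≠ 0 := by
    obtain ⟨x, hx⟩ := hW
    intro h0
    apply hx
    change S x = 0
    rw [h0]
    rfl
  have hSeq : ∀ (l : GL (Fin 2) (v.adicCompletion K)) (x : P.1.toSubmodule),
      S (σ l x) = τ l (S x) := by
    intro l x
    change W.toSubmodule.orthogonalProjectionOnto (T (P.1.toContRep (GLn.ofLocal 2 K v l) x)) =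
      W.toContRep (Quat.ofLocal K D v (e.symm l)) (W.toSubmodule.orthogonalProjectionOnto (T x))
    rw [hT, ContRepresentation.ClosedSubrep.orthogonalProjectionOnto_map_apply hUD W]
  -- a common eigenvector `u` of `GL₂(K_v)` in `π`
  obtain ⟨u, hu0, hev⟩ :=
    exists_common_eigenvector_of_intertwiner_finrank_eq_one σ hσ τ hτ h1 S hS0 hSeq
  -- commutators fix `u`
  have hfix : ∀ g h : GL (Fin 2) (v.adicCompletion K),
      P.1.toContRep (GLn.ofLocal 2 K v (g * h * g⁻¹ * h⁻¹)) u = u := fun g h =>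
    apply_commutator_eq_self_of_common_eigenvector (σ.toRepresentation) u
      (fun g' => hev g') g h
  -- the stabiliser of `u`, a normal subgroup containing the upper unipotents
  let N : Subgroup (GL (Fin 2) (v.adicCompletion K)) :=
    { carrier := {g | P.1.toContRep (GLn.ofLocal 2 K v g) u = u}
      mul_mem' := fun {a b} ha hb => by
        change P.1.toContRep (GLn.ofLocal 2 K v a) u = u at ha
        change P.1.toContRep (GLn.ofLocal 2 K v b) u = u at hb
        change P.1.toContRep (GLn.ofLocal 2 K v (a * b)) u = u
        rw [map_mul, toContRep_mul_apply_gl, hb, ha]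
      one_mem' := by
        change P.1.toContRep (GLn.ofLocal 2 K v 1) u = u
        rw [map_one]
        exact toContRep_one_apply_gl P.1 u
      inv_mem' := fun {a} ha => by
        change P.1.toContRep (GLn.ofLocal 2 K v a) u = u at ha
        change P.1.toContRep (GLn.ofLocal 2 K v a⁻¹) u = u
        conv_lhs => rw [← ha]
        rw [← toContRep_mul_apply_gl, ← map_mul, inv_mul_cancel, map_one]
        exact toContRep_one_apply_gl P.1 u }
  have hN : ∀ {g}, g ∈ N ↔ P.1.toContRep (GLn.ofLocal 2 K v g) u = u := Iff.rfl
  haveI : N.Normal := ⟨fun m hm g => by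
    rw [hN] at hm ⊢
    have : g * m * g⁻¹ = g * m * g⁻¹ * m⁻¹ * m := by group
    rw [this, map_mul, toContRep_mul_apply_gl, hm, hfix]⟩
  have hUN : ∀ u' : ↥(upperUnitriangular (Fin 2) (v.adicCompletion K)),
      (u' : GL (Fin 2) (v.adicCompletion K)) ∈ N := by
    intro u'
    obtain ⟨d, hd⟩ := eq_commutator_of_mem_upperUnitriangular_two u'
    rw [hN]
    have := hfix d u'
    rwa [← hd] at this
  -- hence `ι_v(U₂(K_v))` fixes all of `π`
  have hall : ∀ (u' : ↥(upperUnitriangular (Fin 2) (v.adicCompletion K))) (x : P.1.toSubmodule),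
      P.1.toContRep (GLn.ofLocal 2 K v u') x = x := fun u' x =>
    P.forall_apply_ofLocal_eq_of_normal v N hu0 (fun s hs => hs) x (hUN u')
  -- and the local component of `π` at `v` is not generic: contradiction
  obtain ⟨V₀, _, _, ρ₀, hirr, hadm, j, hj0, hj⟩ := exists_hasLocalComponentAt_holds P v
  haveI := hirr
  obtain ⟨ψ, hψ, hgen⟩ := Shalika1974_isGeneric_of_hasLocalComponentAt_two P v ρ₀ hadm ⟨j, hj0, hj⟩
  refine not_isGeneric_of_upperUnitriangular_le_ker (fun u' => ?_)
    (exists_whittakerCharFun_ne_one le_rfl hψ.2) hgen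
  have hinj := injective_of_isIrreducible_of_intertwines hirr
    (P.1.toContRep.toRepresentation.comp (GLn.ofLocal 2 K v)) hj0 (fun g x => hj g x)
  refine LinearMap.ext fun x => hinj ?_
  rw [Module.End.one_apply, hj]
  exact hall u' (j x)

end NotCharacter


/-! ### Intertwiners defined on an invariant closed subspace of `π` -/

section Subspace

variable {K : Type} [Field K] [NumberField K] {D : Type u} [Ring D] [Algebra K D]
  [Module.Finite K D]
  {μ_D : Measure (AdelicGroupData.units K D).automorphicQuotient}
  [(AdelicGroupData.units K D).IsAutomorphicMeasure μ_D]
  {n : ℕ} {μ : Measure (AdelicGroupData.gl n K).automorphicQuotient}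
  [(AdelicGroupData.gl n K).IsAutomorphicMeasure μ]

/-- **Extension by zero of an intertwiner given on an invariant closed subspace.** Let
`Π ≤ L²(GL_n(K) ℝ_{>0} \ GL_n(𝔸_K))` be closed invariant, `M ≤ Π` a closed subspace invariant under
`GL_n(K_v)` (through `GLn.ofLocal`) for every `v` in a set `A` of finite places, and `T : M → L²(D_𝔸ˣ ⧸ ℝ_{>0} Dˣ)`
a non-zero bounded linear map intertwining `GL_n(K_v)` for `v ∈ A` (through identifications
`e_v : D_vˣ ≃* GL_n(K_v)`). Then `T ∘ proj_M : Π → L²(D_𝔸ˣ ⧸ ℝ_{>0} Dˣ)` is a non-zero bounded intertwiner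
on all of `Π`: the orthogonal projection onto `M` is `GL_n(K_v)`-equivariant because `GL_n(K_v)` acts
unitarily and preserves `M` (`orthogonalProjectionOnto_map_apply` for the restricted representation).
This is how Gelbart's `τ ≅ τ'` (an equivalence of the `G_S`-representations on `M ∩ π` and `M'`,
p. 152) yields the intertwiner of `jacquetLanglands_transfer_surjective_of_intertwiner'`. [folklore] -/
theorem exists_intertwiner_of_subspaceIntertwiner
    (P : ContRepresentation.ClosedSubrep ((AdelicGroupData.gl n K).rightRegular μ))
    (A : Set (HeightOneSpectrum (𝓞 K)))
    (e : ∀ v ∈ A, completionUnits D v ≃* GL (Fin n) (v.adicCompletion K))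
    (M : Submodule ℂ P.toSubmodule) (hMc : IsClosed (M : Set P.toSubmodule))
    (hM : ∀ v ∈ A, ∀ (g : GL (Fin n) (v.adicCompletion K)), ∀ x ∈ M,
      P.toContRep (GLn.ofLocal n K v g) x ∈ M)
    (T : M →L[ℂ] (AdelicGroupData.units K D).L2 μ_D) (hT0 : T ≠ 0)
    (hT : ∀ (v : HeightOneSpectrum (𝓞 K)) (hv : v ∈ A) (g : GL (Fin n) (v.adicCompletion K))
      (x : M), T ⟨P.toContRep (GLn.ofLocal n K v g) x, hM v hv g x x.2⟩ =
        (AdelicGroupData.units K D).rightRegular μ_D (Quat.ofLocal K D v ((e v hv).symm g)) (T x)) :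
    ∃ T' : P.toSubmodule →L[ℂ] (AdelicGroupData.units K D).L2 μ_D, T' ≠ 0 ∧
      ∀ (v : HeightOneSpectrum (𝓞 K)) (hv : v ∈ A) (g : GL (Fin n) (v.adicCompletion K))
        (x : P.toSubmodule), T' (P.toContRep (GLn.ofLocal n K v g) x) =
          (AdelicGroupData.units K D).rightRegular μ_D (Quat.ofLocal K D v ((e v hv).symm g))
            (T' x) := by
  haveI : CompleteSpace M := hMc.completeSpace_coe
  have hUG : ((AdelicGroupData.gl n K).rightRegular μ).IsUnitary :=
    (AdelicGroupData.gl n K).isUnitary_rightRegular μ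
  refine ⟨T.comp M.orthogonalProjectionOnto, fun h0 => hT0 ?_, fun v hv g x => ?_⟩
  · refine ContinuousLinearMap.ext fun m => ?_
    have h1 : T m = (T.comp M.orthogonalProjectionOnto) (m : P.toSubmodule) := by
      rw [ContinuousLinearMap.comp_apply, Submodule.orthogonalProjectionOnto_mem_subspace_eq_self]
    rw [h1, h0]
    rfl
  · -- the projection onto `M` is `GL_n(K_v)`-equivariant
    let σ : ContRepresentation ℂ (GL (Fin n) (v.adicCompletion K)) P.toSubmodule :=
      P.toContRep.restrict (GLn.ofLocal n K v)
    have hσ : σ.IsUnitary := fun l => ClosedSubrep.isUnitary_toContRep hUG P (GLn.ofLocal n K v l)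
    let W : ContRepresentation.ClosedSubrep σ :=
      { toSubmodule := M
        apply_mem_toSubmodule := fun l x hx => hM v hv l x hx
        isClosed' := hMc }
    have hproj : M.orthogonalProjectionOnto (P.toContRep (GLn.ofLocal n K v g) x) =
        ⟨P.toContRep (GLn.ofLocal n K v g) (M.orthogonalProjectionOnto x),
          hM v hv g _ (M.orthogonalProjectionOnto x).2⟩ := by
      have h := ContRepresentation.ClosedSubrep.orthogonalProjectionOnto_map_apply hσ W g x
      exact h
    rw [ContinuousLinearMap.comp_apply, ContinuousLinearMap.comp_apply, hproj, hT v hv g]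

end Subspace

/-! ### Assembly without the orthogonality clause -/

section Assembly

variable (K : Type) [Field K] [NumberField K] (D : Type u) [Ring D] [Algebra K D]
  [IsQuaternionAlgebra K D]

/-- **`jacquetLanglands_transfer_surjective` from intertwiners `π → L²(D_𝔸ˣ ⧸ ℝ_{>0} Dˣ)`, final
form** (Gelbart (1975), proof of Thm. 10.5, claim of p. 152 — "onto" half). Fix splittings
`θ₀_v : D_v ≃ₐ[K_v] M₂(K_v)` at the places `v ∉ Ram_f(D)`. Suppose (`hT`): for `D` a division
quaternion algebra unramified at every infinite place, automorphic measures `μ_D`, `μ`, and every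
cuspidal `π` of `GL₂(𝔸_K)` carrying an essentially-discrete-series irreducible admissible local
component at each `v ∈ Ram_f(D)`, there is a non-zero bounded linear map
`T : π → L²(D_𝔸ˣ ⧸ ℝ_{>0} Dˣ)` which for every finite `v ∉ Ram_f(D)` intertwines the action of
`GL₂(K_v)` on `π` (through `GL₂(K_v) ↪ GL₂(𝔸_K)`) with its action on `L²(D_𝔸ˣ ⧸ ℝ_{>0} Dˣ)` through
`θ₀_v⁻¹ : GL₂(K_v) ≃ D_vˣ ↪ D_𝔸ˣ` (a `G_S`-intertwiner in Gelbart's notation, e.g. the unitary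
equivalence `τ ≅ τ'` on `π ∩ M` extended by zero). Then `jacquetLanglands_transfer_surjective K D`:
the orthogonality of the range of `T` to the one-dimensional constituents required by
`jacquetLanglands_transfer_surjective_of_intertwiner` is automatic — a constituent `W` with
`proj_W ∘ T ≠ 0` has `dim W ≠ 1` by `finrank_ne_one_of_intertwiner` at any place
`v₀ ∉ Ram_f(D)` (which exists: `ramifiedPlaces_finite_holds`, `infinite_heightOneSpectrum`), and
`T x ⊥ W'` for every one-dimensional `W'` as `proj_{W'} (T x) = 0`. What is left under the named
fact is the existence of such `T`: Lemma 10.6 and the comparison of the trace formulas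
(10.10)–(10.22). [cite: Gelbart1975, Thm. 10.5 (ii) (proof, pp. 151–152)] -/
theorem jacquetLanglands_transfer_surjective_of_intertwiner'
    (θ₀ : ∀ v, v ∉ ramifiedPlaces K D →
      (ScalarExtension K (v.adicCompletion K) D ≃ₐ[v.adicCompletion K]
        Matrix (Fin 2) (Fin 2) (v.adicCompletion K)))
    (hT : ∀ (_hdiv : ∀ x : D, x ≠ 0 → IsUnit x)
      (μ_D : Measure (AdelicGroupData.units K D).automorphicQuotient)
      [(AdelicGroupData.units K D).IsAutomorphicMeasure μ_D]
      (μ : Measure (AdelicGroupData.gl 2 K).automorphicQuotient)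
      [(AdelicGroupData.gl 2 K).IsAutomorphicMeasure μ]
      [∀ v : HeightOneSpectrum (𝓞 K), MeasurableSpace (GL (Fin 2) (v.adicCompletion K) ⧸
        Subgroup.center (GL (Fin 2) (v.adicCompletion K)))]
      [∀ v : HeightOneSpectrum (𝓞 K), BorelSpace (GL (Fin 2) (v.adicCompletion K) ⧸
        Subgroup.center (GL (Fin 2) (v.adicCompletion K)))]
      (ν : ∀ v : HeightOneSpectrum (𝓞 K), Measure (GL (Fin 2) (v.adicCompletion K) ⧸
        Subgroup.center (GL (Fin 2) (v.adicCompletion K))))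
      [∀ v, (ν v).IsHaarMeasure],
      ramifiedInfinitePlaces K D = ∅ →
      ∀ π : CuspidalAutomorphicRepGL 2 K μ,
        (∀ v ∈ ramifiedPlaces K D, ∃ (V : Type) (_ : AddCommGroup V) (_ : Module ℂ V)
            (ρ : Representation ℂ (GL (Fin 2) (v.adicCompletion K)) V),
            ρ.IsIrreducible ∧ ρ.IsAdmissible ∧ HasLocalComponentAt π.1 v ρ ∧
              ρ.IsEssentiallyDiscreteSeries (ν v)) →
        ∃ T : π.1.toSubmodule →L[ℂ] (AdelicGroupData.units K D).L2 μ_D, T ≠ 0 ∧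
          ∀ (v : HeightOneSpectrum (𝓞 K)) (hv : v ∉ ramifiedPlaces K D)
            (g : GL (Fin 2) (v.adicCompletion K)) (x : π.1.toSubmodule),
            T (π.1.toContRep (GLn.ofLocal 2 K v g) x) =
              (AdelicGroupData.units K D).rightRegular μ_D
                (Quat.ofLocal K D v ((unitsEquivOfSplitting (θ₀ v hv)).symm g)) (T x)) :
    jacquetLanglands_transfer_surjective K D := by
  refine jacquetLanglands_transfer_surjective_of_sharedLocalComponents K D θ₀
    fun hdiv μ_D _ μ _ _ _ ν _ hinf π hπ => ?_
  obtain ⟨T, hT0, hTeq⟩ := hT hdiv μ_D μ ν hinf π hπ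
  -- a place outside `Ram_f(D)`
  haveI := infinite_heightOneSpectrum K
  have hfin : (ramifiedPlaces K D).Finite := ramifiedPlaces_finite_holds K D
  obtain ⟨v₀, hv₀⟩ := hfin.exists_notMem
  -- a vector with non-zero image, and an irreducible constituent seeing it
  obtain ⟨x₀, hx₀⟩ : ∃ x : π.1.toSubmodule, T x ≠ 0 := by
    by_contra h
    push Not at h
    exact hT0 (ContinuousLinearMap.ext h)
  obtain ⟨W, hWirr, hWx₀⟩ :=
    exists_isTopIrreducible_orthogonalProjectionOnto_ne_zero_of_isDiscretelyDecomposable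
      (isDiscretelyDecomposable_rightRegular_units K D hdiv μ_D) hx₀
  let πD : DiscreteAutomorphicRep (AdelicGroupData.units K D) μ_D := ⟨W, hWirr⟩
  refine ⟨πD, ?_, fun v hv => ?_⟩
  · -- `W` is not one-dimensional
    exact finrank_ne_one_of_intertwiner π (unitsEquivOfSplitting (θ₀ v₀ hv₀)) T (hTeq v₀ hv₀) W
      ⟨x₀, hWx₀⟩
  · -- the irreducible admissible local component of `π` at `v` occurs in `W`
    obtain ⟨V₀, _, _, ρ₀, hρ₀i, hρ₀a, hρ₀l⟩ := exists_hasLocalComponentAt_holds π v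
    refine ⟨V₀, inferInstance, inferInstance, ρ₀, hρ₀i, hρ₀a, hρ₀l, ?_⟩
    exact hasLocalComponentAtD_of_intertwiner π.1 π.2.2 (unitsEquivOfSplitting (θ₀ v hv)) T
      (hTeq v hv) W ⟨x₀, hWx₀⟩ hρ₀l

end Assembly

end Literature.NumberTheory.Automorphic
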